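import Summits.NavierStokesRegularity.FluidComputer.RotorKnobPulseBeable
import Summits.NavierStokesRegularity.FluidComputer.RotorKnobTransition
import Summits.NavierStokesRegularity.FluidComputer.AmplitudeKnob
import HarnessLib

/-!
# The seed–rotor scale knob under the PULSE hypothesis, part 4: Theorem 5.3 for the knob family
# under a polynomial clock and a polynomial × `e^{-Θ(M log K/K)}` knob

Last part of `RotorKnobPulse{Fire,Douse,Beable}.lean` (cell `pub-fluidc`, blueprint seat bp1, gen
24; namespace `Summit.NavierStokesRegularity.FluidComputer.RotorKnob`). HONEST FRAMING (verbatim):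
low prior, high value-of-information experiment on Tao's machine paradigm; NOT a claim that NS blows
up. Everything concerns the five-mode truncation (5.5) of [Tao2016AveragedNS, §5.5] in the two-scale
form `rotorCircuit K M ε ρ` (`RotorKnob.lean`; the diagonal `ρ = ε` is `delayCircuitWith K M ε`, and
`M = K¹⁰`, `ρ = ε` is Tao's circuit) started EXACTLY at (5.6) `delayInit`; nothing is proved about
Navier–Stokes.

MAIN RESULT (`transition_pulseThreshold`). For `K ≥ K₀ = 2·20⁴²·42! + 16`, `3000 log K ≤ M ≤ K¹⁰`,
every POLYNOMIAL clock `0 < ε ≤ K⁻¹⁰⁰` and every seed–rotor scale `0 < ρ` with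
`ρ² ≤ ε · e^{-700·M·log K/K}/K¹⁸⁰⁰` (knob `σ = ρ²/ε ≤ e^{-700·M·log K/K}/K¹⁸⁰⁰`), every trajectory
of `rotorCircuit K M ε ρ` from `delayInit` has a critical time `|t_c - √2| ≤ 24 log K/M`, is quiet
(`a = 1 + O(K⁻¹⁰)`, rest `O(K⁻¹⁰)`, constant 200) on ALL of `[0, t_c]`, and has fired
(`ã = 1 + O(K⁻¹⁰)`, rest `O(K⁻¹⁰)`) for ALL `t ≥ t_c + 880 log K/M + 1/K + 300 log K/K`
(`transition_pulseThreshold_sqrt`: hence from the printed onset `t_c + 880 log K/M + 1/√K` on).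
Compare gen 22 (`RotorKnob.transition_explicit`): the same windows under `ρ⁴ ≤ ε²e^{-18M}/(64M)`,
i.e. `σ ≤ e^{-9M}/(8√M)` — the exponent loses a factor `K/(78 log K)`; and
* (`transition_pulseLinear`) whenever `700·M·log K ≤ K` the knob condition is the FIXED POWER
  `ρ² ≤ ε/K¹⁸⁰¹`, independent of the amplifier;
* (`taoAmplifier_pulse`) for Tao's amplifier `M = K¹⁰` the certified knob condition improves from
  `σ ≤ e^{-9K¹⁰}/(8K⁵)` (gen 22) to `σ ≤ e^{-700K⁹log K}/K¹⁸⁰⁰`;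
* (`pulse_of_exp18`) gen 22's condition implies the pulse hypothesis, so `transition_of_pulse`
  contains `RotorKnob.transition_explicit` (with the earlier fired onset
  `t_c + 880 log K/M + 1/K + 300 log K/K`).
The abstract form `transition_of_pulse` isolates the one inequality the knob must satisfy: the PULSE
HYPOTHESIS `64·M·ρ⁴·e^{4M(T₀ - t_c)} ≤ ε²K²⁰` at the delivery time
`T₀ = t_c + 880 log K/M + 1/K + 300 log K/K` (`rho_pulse_facts`: it implies the two pre-critical
scale conditions `ρ² ≤ ε`, `Mρ⁴ ≤ ε²` of `RotorKnob{,Trigger,Critical}.lean`). On the diagonal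
`ρ = ε` the pulse hypothesis and the threshold are literally those of `AmplitudeKnob.lean` (gen 20),
whose numerics (`eps_poly_facts`, `drain_numeric`, `inv_add_log_le_invSqrt`) are reused by name.

WHY (mechanism, parts 1–3): gen 22 keeps the clock `b ≥ ε/8` on the whole window `[t_c, 2]` by the
crude bound `c ≤ 2ρ²e^{(5t-1)M}`, which costs `ρ⁴ ≤ ε²e^{-Θ(M)}`; but once the drain has delivered
(time `T₀`) the output `ã` is monotone and `a² + b² + c² + d² = 1 - ã²` only decreases, so the clock
has to survive the trigger PULSE `c ≤ 2K⁻¹⁰ρ²e^{2M(t-t_c)}` only up to `T₀`. REMARK (heuristic, NOT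
proved here; cf. the one-sided necessity laws of `GateBudget*.lean`, gen 21/23): for `M ≫ K` some
smallness `σ ≤ K^{-Θ(M/K)}` of the knob is plausibly NECESSARY for the conclusion as stated (the
trigger pulse lasts `Θ(log(ε/ρ²)/M + log K/M)` and must outlast the `Θ(log K/K)` drain), so
`σ₁(K,M) = K^{-Θ(1 + M/K)}` is the conjectured true shape of the knob threshold, up to constants;
this is a SUFFICIENT condition only. [cite: Tao2016AveragedNS, Theorem 5.3, §5.5]. No named facts; 0
sorry.
-/

noncomputable section

namespace Summit.NavierStokesRegularity.FluidComputer.RotorKnob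

open Set Real Filter
open _root_.Topology
open Literature.Analysis.FluidPDE.Tao2016AveragedNS
open Literature.Analysis.FluidPDE.Tao2016AveragedNS.Thm53 (exists_hitTime invSqrt_facts init_c)

/-! ## Numerics of the knob threshold -/

/-- The PULSE HYPOTHESIS at the delivery time implies the two pre-critical scale conditions
`ρ² ≤ ε` and `Mρ⁴ ≤ ε²` (`M ≥ 1`): `e^{4M(T₀ - t_c)} ≥ e^{3520 log K} = K³⁵²⁰ ≥ K²⁰`. [folklore] -/
theorem rho_pulse_facts {K M ε ρ : ℝ} (hK : 16 ≤ K) (hM : 1 ≤ M) (hε : 0 < ε)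
    (hρT : 64 * M * ρ ^ 4 * exp (4 * M * (880 * Real.log K / M + K⁻¹ + 300 * Real.log K / K))
      ≤ ε ^ 2 * K ^ 20) :
    ρ ^ 2 ≤ ε ∧ M * ρ ^ 4 ≤ ε ^ 2 := by
  have hK0 : 0 < K := by linarith
  have hK1 : 1 ≤ K := by linarith
  have hM0 : 0 < M := by linarith
  have hMne : M ≠ 0 := hM0.ne'
  have hKne : K ≠ 0 := hK0.ne'
  have hlog0 : 0 ≤ Real.log K := Real.log_nonneg hK1
  have hE : 4 * M * (880 * Real.log K / M + K⁻¹ + 300 * Real.log K / K)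
      = (3520 : ℕ) * Real.log K + 4 * M * (K⁻¹ + 300 * Real.log K / K) := by
    push_cast; field_simp; ring
  have hexp : K ^ 3520 ≤ exp (4 * M * (880 * Real.log K / M + K⁻¹ + 300 * Real.log K / K)) := by
    rw [hE, exp_add, Real.exp_nat_mul, Real.exp_log hK0]
    have h1 : 1 ≤ exp (4 * M * (K⁻¹ + 300 * Real.log K / K)) := one_le_exp (by positivity)
    nlinarith [pow_pos hK0 3520]
  have hA : M * ρ ^ 4 * (64 * K ^ 3520) ≤ ε ^ 2 * (64 * K ^ 3520) :=
    calc M * ρ ^ 4 * (64 * K ^ 3520) = 64 * M * ρ ^ 4 * K ^ 3520 := by ring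
      _ ≤ 64 * M * ρ ^ 4 * exp (4 * M * (880 * Real.log K / M + K⁻¹ + 300 * Real.log K / K)) :=
          mul_le_mul_of_nonneg_left hexp (by positivity)
      _ ≤ ε ^ 2 * K ^ 20 := hρT
      _ ≤ ε ^ 2 * (64 * K ^ 3520) := by
          apply mul_le_mul_of_nonneg_left _ (sq_nonneg ε)
          have h20 : K ^ 20 ≤ K ^ 3520 := pow_le_pow_right₀ hK1 (by norm_num)
          nlinarith [pow_pos hK0 3520]
  have hMρ : M * ρ ^ 4 ≤ ε ^ 2 := le_of_mul_le_mul_right hA (by positivity)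
  have hρ4 : ρ ^ 4 ≤ ε ^ 2 := (le_mul_of_one_le_left (by positivity) hM).trans hMρ
  have h5 : (ρ ^ 2) ^ 2 ≤ ε ^ 2 := by rw [← pow_mul]; exact hρ4
  exact ⟨le_of_pow_le_pow_left₀ two_ne_zero hε.le h5, hMρ⟩

/-- The knob threshold `ρ² ≤ ε·e^{-700·M·log K/K}/K¹⁸⁰⁰` implies the PULSE HYPOTHESIS at the
delivery time (`AmplitudeKnob.eps_poly_facts` applied to the knob `σ = ρ²/ε` in place of the
amplitude: `64·M·σ²·e^{4M(T₀ - t_c)} ≤ K²⁰`, then multiply by `ε²`). [folklore] -/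
theorem rho_poly_pulse {K M ε ρ : ℝ} (hK : 16 ≤ K) (hM0 : 0 < M) (hMK : M ≤ K ^ 10) (hε : 0 < ε)
    (hρ : 0 < ρ) (hρle : ρ ^ 2 ≤ ε * (exp (-(700 * M * Real.log K / K)) / K ^ 1800)) :
    64 * M * ρ ^ 4 * exp (4 * M * (880 * Real.log K / M + K⁻¹ + 300 * Real.log K / K))
      ≤ ε ^ 2 * K ^ 20 := by
  have hεne : ε ≠ 0 := hε.ne'
  have hσ0 : 0 < ρ ^ 2 / ε := by positivity
  have hσle : ρ ^ 2 / ε ≤ exp (-(700 * M * Real.log K / K)) / K ^ 1800 := by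
    rw [div_le_iff₀ hε, mul_comm]; exact hρle
  obtain ⟨-, -, -, h⟩ := AmplitudeKnob.eps_poly_facts hK hM0 hMK hσ0 hσle
  have hmul := mul_le_mul_of_nonneg_left h (pow_pos hε 2).le
  calc 64 * M * ρ ^ 4 * exp (4 * M * (880 * Real.log K / M + K⁻¹ + 300 * Real.log K / K))
      = ε ^ 2 * (64 * M * (ρ ^ 2 / ε) ^ 2
          * exp (4 * M * (880 * Real.log K / M + K⁻¹ + 300 * Real.log K / K))) := by
        field_simp
    _ ≤ ε ^ 2 * K ^ 20 := hmul

/-- **Gen 22's condition implies the pulse hypothesis**: for `K ≥ K₀` and `3000 log K ≤ M`,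
`ρ⁴ ≤ ε²e^{-18M}/(64M)` gives
`64·M·ρ⁴·e^{4M(T₀ - t_c)} ≤ ε²·e^{-18M + 3520 log K + 4M/K + 1200M log K/K} ≤ ε² ≤ ε²K²⁰`
(`3520 log K ≤ 1.18M`, `4M(1/K + 300 log K/K) ≤ 4M/√K ≤ M`). So `transition_of_pulse` contains
`RotorKnob.transition_explicit`. [folklore] -/
theorem pulse_of_exp18 {K M ε ρ : ℝ} (hK : 2 * 20 ^ 42 * (Nat.factorial 42 : ℝ) + 16 ≤ K)
    (hML : 3000 * Real.log K ≤ M) (hρexp : ρ ^ 4 ≤ ε ^ 2 * exp (-(18 * M)) / (64 * M)) :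
    64 * M * ρ ^ 4 * exp (4 * M * (880 * Real.log K / M + K⁻¹ + 300 * Real.log K / K))
      ≤ ε ^ 2 * K ^ 20 := by
  obtain ⟨hK16, hM0, -, hlog2, -⟩ := Thm53With.family_params hK hML
  have hK0 : 0 < K := by linarith
  have hK1 : 1 ≤ K := by linarith
  have hMne : M ≠ 0 := hM0.ne'
  have hKne : K ≠ 0 := hK0.ne'
  obtain ⟨-, hs4, -⟩ := invSqrt_facts hK16
  have hsK : K⁻¹ + 300 * Real.log K / K ≤ (sqrt K)⁻¹ :=
    AmplitudeKnob.inv_add_log_le_invSqrt (AmplitudeKnob.K0_ge hK)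
  have h1 : 64 * M * ρ ^ 4 ≤ ε ^ 2 * exp (-(18 * M)) := by
    rw [le_div_iff₀ (by positivity)] at hρexp; linarith
  have hE : 4 * M * (880 * Real.log K / M + K⁻¹ + 300 * Real.log K / K)
      = 3520 * Real.log K + 4 * M * (K⁻¹ + 300 * Real.log K / K) := by
    field_simp; ring
  have hsum : -(18 * M) + 4 * M * (880 * Real.log K / M + K⁻¹ + 300 * Real.log K / K) ≤ 0 := by
    rw [hE]
    have h2 : 4 * M * (K⁻¹ + 300 * Real.log K / K) ≤ 4 * M * (1 / 4) :=
      mul_le_mul_of_nonneg_left (hsK.trans hs4) (by positivity)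
    nlinarith
  calc 64 * M * ρ ^ 4 * exp (4 * M * (880 * Real.log K / M + K⁻¹ + 300 * Real.log K / K))
      ≤ ε ^ 2 * exp (-(18 * M))
          * exp (4 * M * (880 * Real.log K / M + K⁻¹ + 300 * Real.log K / K)) :=
        mul_le_mul_of_nonneg_right h1 (exp_pos _).le
    _ = ε ^ 2 * exp (-(18 * M) + 4 * M * (880 * Real.log K / M + K⁻¹ + 300 * Real.log K / K)) := by
        rw [exp_add]; ring
    _ ≤ ε ^ 2 * 1 := mul_le_mul_of_nonneg_left (exp_le_one_iff.2 hsum) (sq_nonneg ε)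
    _ ≤ ε ^ 2 * K ^ 20 := mul_le_mul_of_nonneg_left (one_le_pow₀ hK1) (sq_nonneg ε)

/-! ## Theorem 5.3 for the knob family under the pulse hypothesis, and under the knob threshold -/

/-- **Theorem 5.3 for the two-scale family under the PULSE HYPOTHESIS.** For `K ≥ K₀`,
`3000 log K ≤ M ≤ K¹⁰`, a polynomial clock `0 < ε ≤ K⁻¹⁰⁰` and a seed–rotor scale `0 < ρ` with
`64·M·ρ⁴·e^{4M(880 log K/M + 1/K + 300 log K/K)} ≤ ε²K²⁰`, every trajectory of
`rotorCircuit K M ε ρ` from `delayInit` satisfies the conclusion of Theorem 5.3 —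
`|t_c - √2| ≤ 24 log K/M`, (able) on `[0, t_c]`, (beable) for ALL
`t ≥ t_c + 880 log K/M + 1/K + 300 log K/K`, constants `200K⁻¹⁰`.
[cite: Tao2016AveragedNS, Theorem 5.3, §5.5] -/
theorem transition_of_pulse {K M ε ρ : ℝ} {X : ℝ → Fin 5 → ℝ}
    (hK : 2 * 20 ^ 42 * (Nat.factorial 42 : ℝ) + 16 ≤ K) (hML : 3000 * Real.log K ≤ M)
    (hMK : M ≤ K ^ 10) (hε : 0 < ε) (hε100 : ε ≤ 1 / K ^ 100) (hρ : 0 < ρ)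
    (hρT : 64 * M * ρ ^ 4 * exp (4 * M * (880 * Real.log K / M + K⁻¹ + 300 * Real.log K / K))
      ≤ ε ^ 2 * K ^ 20)
    (h0 : X 0 = delayInit) (hX : ∀ t, HasDerivAt X (rotorCircuit K M ε ρ (X t)) t) :
    ∃ tc : ℝ, |tc - Real.sqrt 2| ≤ 24 * Real.log K / M ∧
      (∀ t ∈ Set.Icc 0 tc,
        |X t 0 - 1| ≤ 200 / K ^ 10 ∧ ∀ i : Fin 5, i ≠ 0 → |X t i| ≤ 200 / K ^ 10) ∧
      (∀ t, tc + 880 * Real.log K / M + 1 / K + 300 * Real.log K / K ≤ t →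
        |X t 4 - 1| ≤ 200 / K ^ 10 ∧ ∀ i : Fin 5, i ≠ 4 → |X t i| ≤ 200 / K ^ 10) := by
  obtain ⟨hK16, hM0, hML48, hlog2, -, hδ, hon, hδle, h2M⟩ := Thm53With.family_params hK hML
  have hK0 : 0 < K := by linarith
  obtain ⟨hε1, hεK⟩ := clock_facts hK16 hε hε100
  have hM1 : 1 ≤ M := by linarith
  obtain ⟨hρε, hMρ⟩ := rho_pulse_facts hK16 hM1 hε hρT
  have hKM : exp (-M) ≤ 1 / K ^ 10 := AmplitudeKnob.exp_neg_le_inv_pow hK0 (by linarith)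
  -- the critical time: first hitting time of the level `K⁻¹⁰ρ²` by `c` on `[0,2]`
  obtain ⟨τ, hτ0, hτ2, hcτ, hτeq⟩ := exists_hitTime (continuous_traj hX 2)
    (θ := ρ ^ 2 / K ^ 10) (T := 2) two_pos (by rw [init_c h0]; positivity)
  obtain ⟨hlo, hhi, hτ1, hτ32, hcτeq⟩ :=
    tc_window hX h0 hε hρ hρε hM0 hMK hK16 hML48 hεK hMρ hτ0 hτ2 hcτ hτeq
  -- the delivery time `T₀ = t_c + δ + 1/K + L` fits inside `[0,2]`
  have hsK : K⁻¹ + 300 * Real.log K / K ≤ (sqrt K)⁻¹ :=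
    AmplitudeKnob.inv_add_log_le_invSqrt (AmplitudeKnob.K0_ge hK)
  have hfit2 : τ + 880 * Real.log K / M + (sqrt K)⁻¹ ≤ 2 :=
    Thm53With.window_fits hK16 hτ1 hhi h2M hδle
  have hT2 : τ + 880 * Real.log K / M + K⁻¹ + 300 * Real.log K / K ≤ 2 := by linarith
  have hρT' : 64 * M * ρ ^ 4 *
      exp (4 * M * (τ + 880 * Real.log K / M + K⁻¹ + 300 * Real.log K / K - τ))
        ≤ ε ^ 2 * K ^ 20 := by
    have : τ + 880 * Real.log K / M + K⁻¹ + 300 * Real.log K / K - τ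
        = 880 * Real.log K / M + K⁻¹ + 300 * Real.log K / K := by ring
    rw [this]; exact hρT
  have hL : 0 ≤ 300 * Real.log K / K := div_nonneg (by linarith) hK0.le
  have hN4 := AmplitudeKnob.drain_numeric hK16
  refine ⟨τ, Thm53With.abs_sub_sqrt_two_le hτ1 (div_nonneg (by linarith) hM0.le)
      (div_le_div_of_nonneg_right (by linarith) hM0.le) hlo hhi, ?_, ?_⟩
  · -- (able), on all of `[0, t_c]`
    intro t ht
    exact able_window hX h0 hε hρ hρε hM0.le hK16 hεK hε100 hτ2 hcτ ht
  · -- (beable), for all later times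
    intro t ht
    rw [one_div] at ht
    have ht0 : 0 ≤ t := by
      have : 0 < K⁻¹ := inv_pos.2 hK0
      linarith
    exact beable_of_sum_sq hX h0 hK16 ht0
      (sum_sq_after hX h0 hε hε1 hρ hρε hM0 hMK hK16 hεK hMρ hε100 hKM hδ hon hL hN4 hτ1 le_rfl
        hT2 hρT' hcτ hcτeq ht)

/-- **Theorem 5.3 for the two-scale family under the knob threshold**
`ρ² ≤ ε·e^{-700·M·log K/K}/K¹⁸⁰⁰` with a POLYNOMIAL clock `ε ≤ K⁻¹⁰⁰` (gen 22,
`RotorKnob.transition_explicit`: `ρ⁴ ≤ ε²e^{-18M}/(64M)`): for `K ≥ K₀ = 2·20⁴²·42! + 16`,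
`3000 log K ≤ M ≤ K¹⁰` and every trajectory of `rotorCircuit K M ε ρ` from `delayInit` —
`|t_c - √2| ≤ 24 log K/M`, (able) on `[0, t_c]`, (beable) for all
`t ≥ t_c + 880 log K/M + 1/K + 300 log K/K`, constants `200K⁻¹⁰`. Framing: low prior, high
value-of-information experiment on Tao's machine paradigm; NOT a claim that NS blows up.
[cite: Tao2016AveragedNS, Theorem 5.3, §5.5] -/
theorem transition_pulseThreshold {K M ε ρ : ℝ} {X : ℝ → Fin 5 → ℝ}
    (hK : 2 * 20 ^ 42 * (Nat.factorial 42 : ℝ) + 16 ≤ K) (hML : 3000 * Real.log K ≤ M)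
    (hMK : M ≤ K ^ 10) (hε : 0 < ε) (hε100 : ε ≤ 1 / K ^ 100) (hρ : 0 < ρ)
    (hρle : ρ ^ 2 ≤ ε * (exp (-(700 * M * Real.log K / K)) / K ^ 1800))
    (h0 : X 0 = delayInit) (hX : ∀ t, HasDerivAt X (rotorCircuit K M ε ρ (X t)) t) :
    ∃ tc : ℝ, |tc - Real.sqrt 2| ≤ 24 * Real.log K / M ∧
      (∀ t ∈ Set.Icc 0 tc,
        |X t 0 - 1| ≤ 200 / K ^ 10 ∧ ∀ i : Fin 5, i ≠ 0 → |X t i| ≤ 200 / K ^ 10) ∧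
      (∀ t, tc + 880 * Real.log K / M + 1 / K + 300 * Real.log K / K ≤ t →
        |X t 4 - 1| ≤ 200 / K ^ 10 ∧ ∀ i : Fin 5, i ≠ 4 → |X t i| ≤ 200 / K ^ 10) := by
  obtain ⟨hK16, hM0, -⟩ := Thm53With.family_params hK hML
  exact transition_of_pulse hK hML hMK hε hε100 hρ (rho_poly_pulse hK16 hM0 hMK hε hρ hρle) h0 hX

/-- The same with the PRINTED onset `t_c + 880 log K/M + 1/√K` of the fired window (the shape of
`RotorKnob.transition_explicit`, since `1/K + 300 log K/K ≤ 1/√K`).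
[cite: Tao2016AveragedNS, Theorem 5.3] -/
theorem transition_pulseThreshold_sqrt {K M ε ρ : ℝ} {X : ℝ → Fin 5 → ℝ}
    (hK : 2 * 20 ^ 42 * (Nat.factorial 42 : ℝ) + 16 ≤ K) (hML : 3000 * Real.log K ≤ M)
    (hMK : M ≤ K ^ 10) (hε : 0 < ε) (hε100 : ε ≤ 1 / K ^ 100) (hρ : 0 < ρ)
    (hρle : ρ ^ 2 ≤ ε * (exp (-(700 * M * Real.log K / K)) / K ^ 1800))
    (h0 : X 0 = delayInit) (hX : ∀ t, HasDerivAt X (rotorCircuit K M ε ρ (X t)) t) :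
    ∃ tc : ℝ, |tc - Real.sqrt 2| ≤ 24 * Real.log K / M ∧
      (∀ t ∈ Set.Icc 0 tc,
        |X t 0 - 1| ≤ 200 / K ^ 10 ∧ ∀ i : Fin 5, i ≠ 0 → |X t i| ≤ 200 / K ^ 10) ∧
      (∀ t, tc + 880 * Real.log K / M + 1 / Real.sqrt K ≤ t →
        |X t 4 - 1| ≤ 200 / K ^ 10 ∧ ∀ i : Fin 5, i ≠ 4 → |X t i| ≤ 200 / K ^ 10) := by
  obtain ⟨tc, htc, hearly, hlate⟩ := transition_pulseThreshold hK hML hMK hε hε100 hρ hρle h0 hX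
  have hsK : K⁻¹ + 300 * Real.log K / K ≤ (sqrt K)⁻¹ :=
    AmplitudeKnob.inv_add_log_le_invSqrt (AmplitudeKnob.K0_ge hK)
  refine ⟨tc, htc, hearly, fun t ht => hlate t ?_⟩
  rw [one_div] at ht ⊢
  linarith

/-- **A fixed power of `K` suffices for every amplifier up to `M ≤ K/(700 log K)`**: if moreover
`700·M·log K ≤ K`, then a clock `0 < ε ≤ K⁻¹⁰⁰` and a knob `ρ² ≤ ε/K¹⁸⁰¹` give the conclusion of
Theorem 5.3 (`e^{-700·M·log K/K} ≥ e⁻¹ > 1/K`). Gen 22 needs `ρ² ≤ ε·e^{-9M}/(8√M)` here.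
[cite: Tao2016AveragedNS, Theorem 5.3, §5.5] -/
theorem transition_pulseLinear {K M ε ρ : ℝ} {X : ℝ → Fin 5 → ℝ}
    (hK : 2 * 20 ^ 42 * (Nat.factorial 42 : ℝ) + 16 ≤ K) (hML : 3000 * Real.log K ≤ M)
    (hMlin : 700 * M * Real.log K ≤ K) (hε : 0 < ε) (hε100 : ε ≤ 1 / K ^ 100) (hρ : 0 < ρ)
    (hρle : ρ ^ 2 ≤ ε / K ^ 1801)
    (h0 : X 0 = delayInit) (hX : ∀ t, HasDerivAt X (rotorCircuit K M ε ρ (X t)) t) :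
    ∃ tc : ℝ, |tc - Real.sqrt 2| ≤ 24 * Real.log K / M ∧
      (∀ t ∈ Set.Icc 0 tc,
        |X t 0 - 1| ≤ 200 / K ^ 10 ∧ ∀ i : Fin 5, i ≠ 0 → |X t i| ≤ 200 / K ^ 10) ∧
      (∀ t, tc + 880 * Real.log K / M + 1 / K + 300 * Real.log K / K ≤ t →
        |X t 4 - 1| ≤ 200 / K ^ 10 ∧ ∀ i : Fin 5, i ≠ 4 → |X t i| ≤ 200 / K ^ 10) := by
  obtain ⟨hK16, hM0, -, hlog2, -⟩ := Thm53With.family_params hK hML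
  have hK0 : 0 < K := by linarith
  have hK1 : 1 ≤ K := by linarith
  -- `M ≤ K/(700 log K) ≤ K¹⁰`
  have hMK : M ≤ K ^ 10 := by
    have h1 : M ≤ 700 * M * Real.log K := by nlinarith
    exact h1.trans (hMlin.trans (le_self_pow₀ hK1 (by norm_num)))
  -- `K⁻¹⁸⁰¹ ≤ e^{-700·M·log K/K}/K¹⁸⁰⁰`
  have hx1 : 700 * M * Real.log K / K ≤ 1 := by rwa [div_le_one hK0]
  have hexp : 1 / K ≤ exp (-(700 * M * Real.log K / K)) := by
    have h1 : exp (-1) ≤ exp (-(700 * M * Real.log K / K)) := exp_le_exp.2 (by linarith)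
    have h2 := Real.exp_neg_one_gt_d9
    have h3 : 1 / K ≤ 1 / 16 := by
      apply div_le_div_of_nonneg_left (by norm_num) (by norm_num) hK16
    linarith
  have hρle' : ρ ^ 2 ≤ ε * (exp (-(700 * M * Real.log K / K)) / K ^ 1800) := by
    refine hρle.trans ?_
    have h1 : ε / K ^ 1801 = ε * (1 / K / K ^ 1800) := by
      rw [div_div, ← pow_succ', mul_one_div]
    rw [h1]
    exact mul_le_mul_of_nonneg_left (div_le_div_of_nonneg_right hexp (by positivity)) hε.le
  exact transition_pulseThreshold hK hML hMK hε hε100 hρ hρle' h0 hX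

/-- **Tao's amplifier** (`M = K¹⁰`; `rotorCircuit K K¹⁰ ε ε` is Tao's circuit (5.5)): Theorem 5.3
with the printed boxes holds for the two-scale family with clock `0 < ε ≤ K⁻¹⁰⁰` and knob
`ρ² ≤ ε·e^{-700K⁹log K}/K¹⁸⁰⁰` (gen 22: `ρ² ≤ ε·e^{-9K¹⁰}/(8K⁵)`): `|t_c - √2| ≤ 24 log K/K¹⁰`,
(able) on `[0, t_c]`, (beable) for all `t ≥ t_c + 880 log K/K¹⁰ + 1/K + 300 log K/K`.
[cite: Tao2016AveragedNS, Theorem 5.3, §5.5] -/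
theorem taoAmplifier_pulse {K ε ρ : ℝ} {X : ℝ → Fin 5 → ℝ}
    (hK : 2 * 20 ^ 42 * (Nat.factorial 42 : ℝ) + 16 ≤ K) (hε : 0 < ε) (hε100 : ε ≤ 1 / K ^ 100)
    (hρ : 0 < ρ) (hρle : ρ ^ 2 ≤ ε * (exp (-(700 * K ^ 9 * Real.log K)) / K ^ 1800))
    (h0 : X 0 = delayInit) (hX : ∀ t, HasDerivAt X (rotorCircuit K (K ^ 10) ε ρ (X t)) t) :
    ∃ tc : ℝ, |tc - Real.sqrt 2| ≤ 24 * Real.log K / K ^ 10 ∧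
      (∀ t ∈ Set.Icc 0 tc,
        |X t 0 - 1| ≤ 200 / K ^ 10 ∧ ∀ i : Fin 5, i ≠ 0 → |X t i| ≤ 200 / K ^ 10) ∧
      (∀ t, tc + 880 * Real.log K / K ^ 10 + 1 / K + 300 * Real.log K / K ≤ t →
        |X t 4 - 1| ≤ 200 / K ^ 10 ∧ ∀ i : Fin 5, i ≠ 4 → |X t i| ≤ 200 / K ^ 10) := by
  have hB : (0 : ℝ) ≤ 2 * 20 ^ 42 * (Nat.factorial 42 : ℝ) := by positivity
  have hK16 : 16 ≤ K := by linarith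
  have hK0 : 0 < K := by linarith
  have hK1 : 1 ≤ K := by linarith
  -- `3000 log K ≤ K¹⁰`: `log K ≤ K` and `3000K ≤ K¹⁰`
  have hML : 3000 * Real.log K ≤ K ^ 10 := by
    have h1 : Real.log K ≤ K := (Real.log_le_sub_one_of_pos hK0).trans (by linarith)
    have h9 : (3000 : ℝ) ≤ K ^ 9 := by
      have : (16 : ℝ) ^ 9 ≤ K ^ 9 := pow_le_pow_left₀ (by norm_num) hK16 9
      norm_num at this
      linarith
    have hl0 : 0 ≤ Real.log K := Real.log_nonneg hK1
    calc 3000 * Real.log K ≤ K ^ 9 * K := mul_le_mul h9 h1 hl0 (by positivity)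
      _ = K ^ 10 := by ring
  have hρle' : ρ ^ 2 ≤ ε * (exp (-(700 * K ^ 10 * Real.log K / K)) / K ^ 1800) := by
    have : 700 * K ^ 10 * Real.log K / K = 700 * K ^ 9 * Real.log K := by
      field_simp
    rw [this]; exact hρle
  exact transition_pulseThreshold hK hML le_rfl hε hε100 hρ hρle' h0 hX

/-- **Gen 24 ⊇ gen 22.** Under the hypotheses of `RotorKnob.transition_explicit` (gen 22:
`ρ⁴ ≤ ε²e^{-18M}/(64M)`) the pulse theorem applies (`pulse_of_exp18`) and gives the fired window
from the EARLIER onset `t_c + 880 log K/M + 1/K + 300 log K/K`.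
[cite: Tao2016AveragedNS, Theorem 5.3] -/
theorem transition_explicit_of_pulse {K M ε ρ : ℝ} {X : ℝ → Fin 5 → ℝ}
    (hK : 2 * 20 ^ 42 * (Nat.factorial 42 : ℝ) + 16 ≤ K) (hML : 3000 * Real.log K ≤ M)
    (hMK : M ≤ K ^ 10) (hε : 0 < ε) (hε100 : ε ≤ 1 / K ^ 100)
    (hρ : 0 < ρ) (hρexp : ρ ^ 4 ≤ ε ^ 2 * exp (-(18 * M)) / (64 * M))
    (h0 : X 0 = delayInit) (hX : ∀ t, HasDerivAt X (rotorCircuit K M ε ρ (X t)) t) :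
    ∃ tc : ℝ, |tc - Real.sqrt 2| ≤ 24 * Real.log K / M ∧
      (∀ t ∈ Set.Icc 0 tc,
        |X t 0 - 1| ≤ 200 / K ^ 10 ∧ ∀ i : Fin 5, i ≠ 0 → |X t i| ≤ 200 / K ^ 10) ∧
      (∀ t, tc + 880 * Real.log K / M + 1 / K + 300 * Real.log K / K ≤ t →
        |X t 4 - 1| ≤ 200 / K ^ 10 ∧ ∀ i : Fin 5, i ≠ 4 → |X t i| ≤ 200 / K ^ 10) :=
  transition_of_pulse hK hML hMK hε hε100 hρ (pulse_of_exp18 hK hML hρexp) h0 hX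

end Summit.NavierStokesRegularity.FluidComputer.RotorKnob
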